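import Summits.ABC.StewartYu.PadicG3ExitBPrep
import HarnessLib

/-!
# Cell abc-stewartyu, Gen-3 record (WP-M3.R): exit B of the END — the assembly

`Summits/ABC/StewartYu/PadicG3ExitB.lean` — cell `abc-stewartyu` (HOME `run/shared/lean/pub/abc-stewartyu/`),
route `PadicPrimesKummerThird`, cruxes `Y07Odd` (stmt-ABC-19658) / `Y07Two` (stmt-ABC-19659); seat lp-1 (g2),
record parcel (R2); sequel of `PadicG3ExitBPrep.lean` (lemmas) — see there for the mathematics
(Nesterenko 2003 Lemma 5.4 in the letters of `PadicG3Par`, height case split (5.18), cancellations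
`X ↔ 2X_fin`, `Ω ↔ ∏ 1/Aⱼ`, `K ↔ 2^Ŝ` under the RULED instantiation convention `K ≤ N_q`
(plan g8 2026-08-27T01:00:18Z), and the master inequality of `RecordExitsMaster`).  Theorems only.

* `exitB_one (hKNq)` — the `d₀ = 1` line `(n+1)!·(n−1)!·2ⁿ·∏ Dⱼ < (S₀+1)^{n−1}·(2X_fin+1)`;
* `exitB_zero (hKNq)` — the `d₀ = 0` line `(n+1)!·n!·2ⁿ·D₀·∏ Dⱼ < (S₀+1)ⁿ·(2X_fin+1)`;
* `exitB (hKNq : P.K ≤ P.Nq)` — hypothesis `hB` of `RecordAssembly.recordTwo_of_ineqs` /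
  `recordOdd_of_ineqs` VERBATIM for `(D₀, S₀, X, D) := (P.D₀, P.S₀N, P.Xfin, P.D)`, via
  `RecordExitsNumeric.exitB_of_bounds`.

WHAT THIS IS NOT: no crux moves; clause (C) is the next file.

References: Yu. V. Nesterenko, LNM 1819 (2003), §5.2 (5.12)–(5.18), Lemma 5.4.
-/

noncomputable section

open Finset Real Nat

namespace Summit.ABC.StewartYu

namespace PadicG3Par

open Summit.ABC.StewartYu.RecordExitsNumeric

variable {n : ℕ} (P : PadicG3Par n)

/-- The common real-number facts of the four cases: `s = S₀+1`, `xf = 2X_fin+1`.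
`16(n+1)L ≤ s(n+2)⁴`, `2^{n+23} ≤ 2^{Ŝ−1}`, `2^{Ŝ−1}X < xf`, `2^{n+22}K < 2^{Ŝ−1}` (under `K ≤ N_q`).
[folklore] -/
theorem end_facts (hKNq : P.K ≤ P.Nq) :
    (16 : ℝ) * (n + 1) * P.L ≤ ((P.S₀N : ℝ) + 1) * ((n : ℝ) + 2) ^ 4 ∧
    (2 : ℝ) ^ (n + 23) ≤ 2 ^ (P.Sdepth - 1) ∧
    (2 : ℝ) ^ (P.Sdepth - 1) * P.X < 2 * (P.Xfin : ℝ) + 1 ∧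
    (2 : ℝ) ^ (n + 22) * P.K < 2 ^ (P.Sdepth - 1) := by
  refine ⟨P.sixteen_mul_L_lt.le, by exact_mod_cast P.two_pow_le_two_pow_Sdepth_pred, ?_,
    by exact_mod_cast P.two_pow_mul_K_lt hKNq⟩
  have h : (2 : ℝ) ^ (P.Sdepth - 1) * P.X ≤ 2 * (P.Xfin : ℝ) := by
    exact_mod_cast P.two_pow_mul_X_le_two_Xfin
  linarith

/-- **Exit B, `d₀ = 1` (`G* = 𝔾ₐ`)**: `(n+1)!·(n−1)!·2ⁿ·∏ Dⱼ < (S₀+1)^{n−1}·(2X_fin+1)`.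
[cite: Nesterenko2003, §5.2 Lemma 5.4] -/
theorem exitB_one (hKNq : P.K ≤ P.Nq) :
    (n + 1)! * (n - 1)! * 2 ^ n * ∏ j, P.D j < (P.S₀N + 1) ^ (n - 1) * (2 * P.Xfin + 1) := by
  obtain ⟨hs, h23, hxf, hK⟩ := P.end_facts hKNq
  obtain ⟨k, hk⟩ : ∃ k, n = k + 1 := ⟨n - 1, (Nat.sub_add_cancel P.hn).symm⟩
  subst hk
  simp only [Nat.add_sub_cancel]
  -- real-number form
  have hL : (0 : ℝ) < P.L := by linarith [P.one_le_L]
  have hs0 : (0 : ℝ) < (P.S₀N : ℝ) + 1 := by positivity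
  have hX1 : (1 : ℝ) ≤ P.X := by exact_mod_cast P.one_le_X
  have hK1 : (1 : ℝ) ≤ P.K := by exact_mod_cast P.one_le_K
  set s : ℝ := (P.S₀N : ℝ) + 1 with hsdef
  set xf : ℝ := 2 * (P.Xfin : ℝ) + 1 with hxfdef
  set L : ℝ := (P.L : ℝ) with hLdef
  -- `16(k+2)L ≤ s (k+3)^4`
  have hs' : 16 * ((k : ℝ) + 2) * L ≤ s * ((k : ℝ) + 3) ^ 4 := by
    have := hs; push_cast at this; rw [hsdef]; nlinarith
  have hbase : 0 ≤ 16 * ((k : ℝ) + 2) * L := by positivity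
  suffices hreal : (((k + 1 + 1)! : ℕ) : ℝ) * ((k ! : ℕ) : ℝ) * 2 ^ (k + 1) * ∏ j, (P.D j : ℝ) < s ^ k * xf by
    rw [hsdef, hxfdef] at hreal
    exact_mod_cast hreal
  -- the largest height
  obtain ⟨j₀, -, hj₀⟩ := Finset.exists_max_image (univ : Finset (Fin (k + 1))) P.A ⟨0, mem_univ _⟩
  have hprod0 : 0 ≤ ∏ j, (P.D j : ℝ) := prod_nonneg fun j _ => by positivity
  by_cases hlt : (P.Nq : ℝ) * P.L / 2 ^ P.Sdepth < P.A j₀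
  · -- case (i): `D_{j₀} = 1`, `∏ D ≤ (L/2^{k+22})^k`
    have hprod := P.prod_D_le_of_lt hlt
    simp only [Nat.add_sub_cancel] at hprod
    have hnum : (((k + 2)! * k ! * 2 ^ (k + 1) * (k + 3) ^ (4 * k) : ℕ) : ℝ) ≤
        (((16 * (k + 2)) ^ k * 2 ^ ((k + 22) * k) * 2 ^ (k + 24) : ℕ) : ℝ) := by
      exact_mod_cast numB1i k
    push_cast at hnum
    set Q : ℝ := (16 * ((k : ℝ) + 2)) ^ k * 2 ^ ((k + 22) * k) with hQ
    have hQ0 : 0 < Q := by positivity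
    -- `(L/2^{k+22})^k · Q = (16(k+2)L)^k ≤ (s (k+3)^4)^k`
    have e1 : (L / 2 ^ (k + 1 + 21)) ^ k * Q = (16 * ((k : ℝ) + 2) * L) ^ k := by
      rw [hQ, show k + 1 + 21 = k + 22 by ring]
      simp only [mul_pow, div_pow]
      rw [← pow_mul]
      field_simp
    have hpow : (16 * ((k : ℝ) + 2) * L) ^ k ≤ (s * ((k : ℝ) + 3) ^ 4) ^ k :=
      pow_le_pow_left₀ hbase hs' k
    have key : (((k + 1 + 1)! : ℕ) : ℝ) * ((k ! : ℕ) : ℝ) * 2 ^ (k + 1) * (∏ j, (P.D j : ℝ)) * Q ≤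
        (2 ^ (k + 24) * s ^ k) * Q := by
      calc (((k + 1 + 1)! : ℕ) : ℝ) * ((k ! : ℕ) : ℝ) * 2 ^ (k + 1) * (∏ j, (P.D j : ℝ)) * Q
          ≤ (((k + 1 + 1)! : ℕ) : ℝ) * ((k ! : ℕ) : ℝ) * 2 ^ (k + 1) * (L / 2 ^ (k + 1 + 21)) ^ k * Q := by
            gcongr
        _ = (((k + 1 + 1)! : ℕ) : ℝ) * ((k ! : ℕ) : ℝ) * 2 ^ (k + 1) * ((L / 2 ^ (k + 1 + 21)) ^ k * Q) := by
            ring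
        _ ≤ (((k + 1 + 1)! : ℕ) : ℝ) * ((k ! : ℕ) : ℝ) * 2 ^ (k + 1) * (s * ((k : ℝ) + 3) ^ 4) ^ k := by
            rw [e1]; gcongr
        _ = ((((k + 2)! : ℕ) : ℝ) * ((k ! : ℕ) : ℝ) * 2 ^ (k + 1) * ((k : ℝ) + 3) ^ (4 * k)) * s ^ k := by
            rw [mul_pow, ← pow_mul, show k + 1 + 1 = k + 2 by ring]; ring
        _ ≤ ((16 * ((k : ℝ) + 2)) ^ k * 2 ^ ((k + 22) * k) * 2 ^ (k + 24)) * s ^ k :=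
            mul_le_mul_of_nonneg_right hnum (by positivity)
        _ = (2 ^ (k + 24) * s ^ k) * Q := by rw [hQ]; ring
    have hmain := le_of_mul_le_mul_right key hQ0
    -- `2^{k+24} s^k ≤ 2^{Ŝ-1} s^k ≤ 2^{Ŝ-1} X s^k < xf s^k`
    have h1 : (2 : ℝ) ^ (k + 24) ≤ 2 ^ (P.Sdepth - 1) := by
      simpa [show k + 1 + 23 = k + 24 by ring] using h23
    have h2 : (2 : ℝ) ^ (P.Sdepth - 1) ≤ 2 ^ (P.Sdepth - 1) * P.X :=
      le_mul_of_one_le_right (by positivity) hX1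
    have hsk : 0 < s ^ k := by positivity
    calc (((k + 1 + 1)! : ℕ) : ℝ) * ((k ! : ℕ) : ℝ) * 2 ^ (k + 1) * ∏ j, (P.D j : ℝ)
        ≤ 2 ^ (k + 24) * s ^ k := hmain
      _ ≤ 2 ^ (P.Sdepth - 1) * P.X * s ^ k := by gcongr; exact h1.trans h2
      _ < xf * s ^ k := mul_lt_mul_of_pos_right hxf hsk
      _ = s ^ k * xf := mul_comm _ _
  · -- case (ii): all `A_j ≤ ρ`, `Ω ∏ D ≤ (L/2^{k+23})^{k+1}`
    have hle : ∀ j, P.A j ≤ (P.Nq : ℝ) * P.L / 2 ^ P.Sdepth := fun j =>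
      (hj₀ j (mem_univ j)).trans (not_lt.mp hlt)
    have hprod := P.Ω_mul_prod_D_le_of_le hle
    have hΩ := P.Ω_pos
    have hnum : ((2 * ((k + 1)! * k ! * 2 ^ (k + 1) * (k + 3) ^ (4 * k) * 87 ^ (k + 1)) : ℕ) : ℝ) ≤
        ((3 * ((16 * (k + 2)) ^ k * 2 ^ ((k + 1) * (k + 23)) * 2 ^ (k + 23)) : ℕ) : ℝ) := by
      exact_mod_cast numB1ii k
    push_cast at hnum
    have hCb := Cb_le
    have hCb0 : (0 : ℝ) ≤ Cb := by unfold Cb cM; positivity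
    have hCbpow : Cb ^ (k + 1) ≤ (87 : ℝ) ^ (k + 1) := pow_le_pow_left₀ hCb0 hCb _
    have h3L := P.three_halves_mul_L_le
    push_cast at h3L
    -- `3 (k+2) L ≤ 2 X (Cb^{k+1} Ω K)`
    have h3L' : 3 * ((k : ℝ) + 2) * L ≤ 2 * P.X * (Cb ^ (k + 1) * P.Ω * P.K) := by
      rw [hLdef]; nlinarith
    set Q : ℝ := (16 * ((k : ℝ) + 2)) ^ k * 2 ^ ((k + 1) * (k + 23)) * (3 * ((k : ℝ) + 2)) with hQ
    have hQ0 : 0 < Q := by positivity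
    -- `(L/2^{k+23})^{k+1} · (16(k+2))^k 2^{(k+1)(k+23)} · 3(k+2) = (16(k+2)L)^k · 3(k+2) L`
    have e1 : (L / 2 ^ (k + 1 + 22)) ^ (k + 1) * Q =
        (16 * ((k : ℝ) + 2) * L) ^ k * (3 * ((k : ℝ) + 2) * L) := by
      rw [hQ, show k + 1 + 22 = k + 23 by ring, mul_comm (k + 1) (k + 23)]
      simp only [mul_pow, div_pow]
      rw [← pow_mul]
      field_simp
      ring
    have hpow : (16 * ((k : ℝ) + 2) * L) ^ k ≤ (s * ((k : ℝ) + 3) ^ 4) ^ k :=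
      pow_le_pow_left₀ hbase hs' k
    have hfac : (((k + 1 + 1)! : ℕ) : ℝ) = ((k : ℝ) + 2) * (((k + 1)! : ℕ) : ℝ) := by
      rw [show k + 1 + 1 = (k + 1) + 1 by ring, Nat.factorial_succ]; push_cast; ring
    have key : (((k + 1 + 1)! : ℕ) : ℝ) * ((k ! : ℕ) : ℝ) * 2 ^ (k + 1) * (∏ j, (P.D j : ℝ)) *
          (P.Ω * Q) ≤ (2 ^ (k + 23) * P.K * P.X * s ^ k) * (P.Ω * Q) := by
      calc (((k + 1 + 1)! : ℕ) : ℝ) * ((k ! : ℕ) : ℝ) * 2 ^ (k + 1) * (∏ j, (P.D j : ℝ)) * (P.Ω * Q)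
          = (((k + 1 + 1)! : ℕ) : ℝ) * ((k ! : ℕ) : ℝ) * 2 ^ (k + 1) * (P.Ω * ∏ j, (P.D j : ℝ)) * Q := by
            ring
        _ ≤ (((k + 1 + 1)! : ℕ) : ℝ) * ((k ! : ℕ) : ℝ) * 2 ^ (k + 1) * (L / 2 ^ (k + 1 + 22)) ^ (k + 1) * Q := by
            gcongr
        _ = (((k + 1 + 1)! : ℕ) : ℝ) * ((k ! : ℕ) : ℝ) * 2 ^ (k + 1) *
              ((16 * ((k : ℝ) + 2) * L) ^ k * (3 * ((k : ℝ) + 2) * L)) := by rw [← e1]; ring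
        _ ≤ (((k + 1 + 1)! : ℕ) : ℝ) * ((k ! : ℕ) : ℝ) * 2 ^ (k + 1) *
              ((s * ((k : ℝ) + 3) ^ 4) ^ k * (2 * P.X * (Cb ^ (k + 1) * P.Ω * P.K))) := by
            gcongr
        _ = ((k : ℝ) + 2) * (2 * ((((k + 1)! : ℕ) : ℝ) * ((k ! : ℕ) : ℝ) * 2 ^ (k + 1) *
              ((k : ℝ) + 3) ^ (4 * k) * Cb ^ (k + 1))) * (s ^ k * P.X * P.Ω * P.K) := by
            rw [hfac, mul_pow, ← pow_mul]; ring
        _ ≤ ((k : ℝ) + 2) * (2 * ((((k + 1)! : ℕ) : ℝ) * ((k ! : ℕ) : ℝ) * 2 ^ (k + 1) *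
              ((k : ℝ) + 3) ^ (4 * k) * 87 ^ (k + 1))) * (s ^ k * P.X * P.Ω * P.K) := by
            gcongr
        _ ≤ ((k : ℝ) + 2) * (3 * ((16 * ((k : ℝ) + 2)) ^ k * 2 ^ ((k + 1) * (k + 23)) * 2 ^ (k + 23))) *
              (s ^ k * P.X * P.Ω * P.K) := by
            gcongr
        _ = (2 ^ (k + 23) * P.K * P.X * s ^ k) * (P.Ω * Q) := by rw [hQ]; ring
    have hmain := le_of_mul_le_mul_right key (by positivity)
    have hK' : (2 : ℝ) ^ (k + 23) * P.K < 2 ^ (P.Sdepth - 1) := by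
      simpa [show k + 1 + 22 = k + 23 by ring] using hK
    have hsk : 0 < s ^ k := by positivity
    have hX0 : (0 : ℝ) < P.X := by linarith
    calc (((k + 1 + 1)! : ℕ) : ℝ) * ((k ! : ℕ) : ℝ) * 2 ^ (k + 1) * ∏ j, (P.D j : ℝ)
        ≤ 2 ^ (k + 23) * P.K * P.X * s ^ k := hmain
      _ < 2 ^ (P.Sdepth - 1) * P.X * s ^ k := by
          apply mul_lt_mul_of_pos_right _ hsk
          exact mul_lt_mul_of_pos_right hK' hX0
      _ < xf * s ^ k := mul_lt_mul_of_pos_right hxf hsk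
      _ = s ^ k * xf := mul_comm _ _

/-- **Exit B, `d₀ = 0` (`G* = {e}`)**: `(n+1)!·n!·2ⁿ·D₀·∏ Dⱼ < (S₀+1)ⁿ·(2X_fin+1)`.
[cite: Nesterenko2003, §5.2 Lemma 5.4] -/
theorem exitB_zero (hKNq : P.K ≤ P.Nq) :
    (n + 1)! * n ! * 2 ^ n * P.D₀ * ∏ j, P.D j < (P.S₀N + 1) ^ n * (2 * P.Xfin + 1) := by
  obtain ⟨hs, h23, hxf, hK⟩ := P.end_facts hKNq
  obtain ⟨k, hk⟩ : ∃ k, n = k + 1 := ⟨n - 1, (Nat.sub_add_cancel P.hn).symm⟩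
  subst hk
  have hL : (0 : ℝ) < P.L := by linarith [P.one_le_L]
  have hL24 : (2 : ℝ) ^ (k + 1 + 24) ≤ P.L := by exact_mod_cast P.two_pow_le_L
  have hs0 : (0 : ℝ) < (P.S₀N : ℝ) + 1 := by positivity
  have hX1 : (1 : ℝ) ≤ P.X := by exact_mod_cast P.one_le_X
  have hK1 : (1 : ℝ) ≤ P.K := by exact_mod_cast P.one_le_K
  set s : ℝ := (P.S₀N : ℝ) + 1 with hsdef
  set xf : ℝ := 2 * (P.Xfin : ℝ) + 1 with hxfdef
  set L : ℝ := (P.L : ℝ) with hLdef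
  have hs' : 16 * ((k : ℝ) + 2) * L ≤ s * ((k : ℝ) + 3) ^ 4 := by
    have := hs; push_cast at this; rw [hsdef]; nlinarith
  have hbase : 0 ≤ 16 * ((k : ℝ) + 2) * L := by positivity
  suffices hreal : (((k + 1 + 1)! : ℕ) : ℝ) * (((k + 1)! : ℕ) : ℝ) * 2 ^ (k + 1) * (P.D₀ : ℝ) *
      ∏ j, (P.D j : ℝ) < s ^ (k + 1) * xf by
    rw [hsdef, hxfdef] at hreal
    exact_mod_cast hreal
  obtain ⟨j₀, -, hj₀⟩ := Finset.exists_max_image (univ : Finset (Fin (k + 1))) P.A ⟨0, mem_univ _⟩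
  have hprod0 : 0 ≤ ∏ j, (P.D j : ℝ) := prod_nonneg fun j _ => by positivity
  have hD₀0 : (0 : ℝ) ≤ P.D₀ := by positivity
  by_cases hlt : (P.Nq : ℝ) * P.L / 2 ^ P.Sdepth < P.A j₀
  · -- case (i): `∏ D ≤ (L/2^{k+22})^k`, `D₀ ≤ X L/2`
    have hprod := P.prod_D_le_of_lt hlt
    simp only [Nat.add_sub_cancel] at hprod
    have hD₀ : (P.D₀ : ℝ) ≤ P.X * L / 2 := by
      have h := P.D₀_le
      have h24 : (2 : ℝ) ^ 24 ≤ 2 ^ (k + 1 + 24) := pow_le_pow_right₀ (by norm_num) (by omega)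
      have : (2 : ℝ) ^ 24 ≤ P.X * L := by rw [hLdef]; nlinarith
      rw [hLdef] at this ⊢; linarith
    have hnum : (((k + 2)! * (k + 1)! * 2 ^ k * (k + 3) ^ (4 * (k + 1)) : ℕ) : ℝ) ≤
        (((16 * (k + 2)) ^ (k + 1) * 2 ^ ((k + 22) * k) * 2 ^ (k + 24) : ℕ) : ℝ) := by
      exact_mod_cast numB0i k
    push_cast at hnum
    set Q : ℝ := (16 * ((k : ℝ) + 2)) ^ (k + 1) * 2 ^ ((k + 22) * k) with hQ
    have hQ0 : 0 < Q := by positivity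
    -- `L (L/2^{k+22})^k Q = (16(k+2)L)^{k+1}`
    have e1 : L * (L / 2 ^ (k + 1 + 21)) ^ k * Q = (16 * ((k : ℝ) + 2) * L) ^ (k + 1) := by
      rw [hQ, show k + 1 + 21 = k + 22 by ring]
      simp only [mul_pow, div_pow]
      rw [← pow_mul]
      field_simp
      ring
    have hpow : (16 * ((k : ℝ) + 2) * L) ^ (k + 1) ≤ (s * ((k : ℝ) + 3) ^ 4) ^ (k + 1) :=
      pow_le_pow_left₀ hbase hs' _
    have key : (((k + 1 + 1)! : ℕ) : ℝ) * (((k + 1)! : ℕ) : ℝ) * 2 ^ (k + 1) * (P.D₀ : ℝ) *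
          (∏ j, (P.D j : ℝ)) * Q ≤ (2 ^ (k + 24) * P.X * s ^ (k + 1)) * Q := by
      calc (((k + 1 + 1)! : ℕ) : ℝ) * (((k + 1)! : ℕ) : ℝ) * 2 ^ (k + 1) * (P.D₀ : ℝ) * (∏ j, (P.D j : ℝ)) * Q
          ≤ (((k + 1 + 1)! : ℕ) : ℝ) * (((k + 1)! : ℕ) : ℝ) * 2 ^ (k + 1) * (P.X * L / 2) *
              (L / 2 ^ (k + 1 + 21)) ^ k * Q := by gcongr
        _ = (((k + 1 + 1)! : ℕ) : ℝ) * (((k + 1)! : ℕ) : ℝ) * 2 ^ k * P.X *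
              (L * (L / 2 ^ (k + 1 + 21)) ^ k * Q) := by rw [pow_succ]; ring
        _ ≤ (((k + 1 + 1)! : ℕ) : ℝ) * (((k + 1)! : ℕ) : ℝ) * 2 ^ k * P.X *
              (s * ((k : ℝ) + 3) ^ 4) ^ (k + 1) := by rw [e1]; gcongr
        _ = ((((k + 2)! : ℕ) : ℝ) * (((k + 1)! : ℕ) : ℝ) * 2 ^ k * ((k : ℝ) + 3) ^ (4 * (k + 1))) *
              P.X * s ^ (k + 1) := by
            rw [mul_pow, ← pow_mul, show k + 1 + 1 = k + 2 by ring]; ring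
        _ ≤ ((16 * ((k : ℝ) + 2)) ^ (k + 1) * 2 ^ ((k + 22) * k) * 2 ^ (k + 24)) * P.X * s ^ (k + 1) := by
            gcongr
        _ = (2 ^ (k + 24) * P.X * s ^ (k + 1)) * Q := by rw [hQ]; ring
    have hmain := le_of_mul_le_mul_right key hQ0
    have h1 : (2 : ℝ) ^ (k + 24) ≤ 2 ^ (P.Sdepth - 1) := by
      simpa [show k + 1 + 23 = k + 24 by ring] using h23
    have hsk : 0 < s ^ (k + 1) := by positivity
    have hX0 : (0 : ℝ) < P.X := by linarith
    calc (((k + 1 + 1)! : ℕ) : ℝ) * (((k + 1)! : ℕ) : ℝ) * 2 ^ (k + 1) * (P.D₀ : ℝ) * ∏ j, (P.D j : ℝ)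
        ≤ 2 ^ (k + 24) * P.X * s ^ (k + 1) := hmain
      _ ≤ 2 ^ (P.Sdepth - 1) * P.X * s ^ (k + 1) := by gcongr
      _ < xf * s ^ (k + 1) := mul_lt_mul_of_pos_right hxf hsk
      _ = s ^ (k + 1) * xf := mul_comm _ _
  · -- case (ii): `Ω ∏ D ≤ (L/2^{k+23})^{k+1}`, `D₀ ≤ 8 X Cb^{k+1} Ω K`
    have hle : ∀ j, P.A j ≤ (P.Nq : ℝ) * P.L / 2 ^ P.Sdepth := fun j =>
      (hj₀ j (mem_univ j)).trans (not_lt.mp hlt)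
    have hprod := P.Ω_mul_prod_D_le_of_le hle
    have hΩ := P.Ω_pos
    have hD₀ := P.D₀_le_eight
    have hnum : (((k + 2)! * (k + 1)! * 2 ^ (k + 4) * 87 ^ (k + 1) * (k + 3) ^ (4 * (k + 1)) : ℕ) : ℝ) ≤
        (((16 * (k + 2)) ^ (k + 1) * 2 ^ ((k + 1) * (k + 23)) * 2 ^ (k + 23) : ℕ) : ℝ) := by
      exact_mod_cast numB0ii k
    push_cast at hnum
    have hCb := Cb_le
    have hCb0 : (0 : ℝ) ≤ Cb := by unfold Cb cM; positivity
    have hCbpow : Cb ^ (k + 1) ≤ (87 : ℝ) ^ (k + 1) := pow_le_pow_left₀ hCb0 hCb _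
    set Q : ℝ := (16 * ((k : ℝ) + 2)) ^ (k + 1) * 2 ^ ((k + 1) * (k + 23)) with hQ
    have hQ0 : 0 < Q := by positivity
    have e1 : (L / 2 ^ (k + 1 + 22)) ^ (k + 1) * Q = (16 * ((k : ℝ) + 2) * L) ^ (k + 1) := by
      rw [hQ, show k + 1 + 22 = k + 23 by ring, mul_comm (k + 1) (k + 23)]
      simp only [mul_pow, div_pow]
      rw [← pow_mul]
      field_simp
    have hpow : (16 * ((k : ℝ) + 2) * L) ^ (k + 1) ≤ (s * ((k : ℝ) + 3) ^ 4) ^ (k + 1) :=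
      pow_le_pow_left₀ hbase hs' _
    -- abbreviations
    set A : ℝ := (((k + 1 + 1)! : ℕ) : ℝ) * (((k + 1)! : ℕ) : ℝ) * 2 ^ (k + 1) with hA
    have hA0 : 0 ≤ A := by positivity
    have hXΩK : 0 ≤ 8 * (P.X : ℝ) * (Cb ^ (k + 1) * P.Ω * P.K) := by
      have := P.K_pos; positivity
    -- step 1: `D₀ · (Ω ∏D) ≤ 8X(Cb^{k+1} Ω K) · (L/2^{k+23})^{k+1}`
    have step1 : (P.D₀ : ℝ) * (P.Ω * ∏ j, (P.D j : ℝ)) ≤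
        (8 * P.X * (Cb ^ (k + 1) * P.Ω * P.K)) * (L / 2 ^ (k + 1 + 22)) ^ (k + 1) :=
      mul_le_mul hD₀ hprod (mul_nonneg hΩ.le hprod0) hXΩK
    -- step 2: `(L/2^{k+23})^{k+1} · Q ≤ (s (k+3)^4)^{k+1}`
    have step2 : (L / 2 ^ (k + 1 + 22)) ^ (k + 1) * Q ≤ (s * ((k : ℝ) + 3) ^ 4) ^ (k + 1) := by
      rw [e1]; exact hpow
    -- step 3: `Cb^{k+1} ≤ 87^{k+1}` inside the constant, then the master corollary
    have step3 : (((k + 2)! : ℕ) : ℝ) * (((k + 1)! : ℕ) : ℝ) * 2 ^ (k + 4) * Cb ^ (k + 1) *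
        ((k : ℝ) + 3) ^ (4 * (k + 1)) ≤
        (16 * ((k : ℝ) + 2)) ^ (k + 1) * 2 ^ ((k + 1) * (k + 23)) * 2 ^ (k + 23) := by
      refine le_trans ?_ hnum
      have h0 : 0 ≤ (((k + 2)! : ℕ) : ℝ) * (((k + 1)! : ℕ) : ℝ) * 2 ^ (k + 4) * ((k : ℝ) + 3) ^ (4 * (k + 1)) := by
        positivity
      calc (((k + 2)! : ℕ) : ℝ) * (((k + 1)! : ℕ) : ℝ) * 2 ^ (k + 4) * Cb ^ (k + 1) * ((k : ℝ) + 3) ^ (4 * (k + 1))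
          = (((k + 2)! : ℕ) : ℝ) * (((k + 1)! : ℕ) : ℝ) * 2 ^ (k + 4) * ((k : ℝ) + 3) ^ (4 * (k + 1)) *
              Cb ^ (k + 1) := by ring
        _ ≤ (((k + 2)! : ℕ) : ℝ) * (((k + 1)! : ℕ) : ℝ) * 2 ^ (k + 4) * ((k : ℝ) + 3) ^ (4 * (k + 1)) *
              87 ^ (k + 1) := mul_le_mul_of_nonneg_left hCbpow h0
        _ = (((k + 2)! : ℕ) : ℝ) * (((k + 1)! : ℕ) : ℝ) * 2 ^ (k + 4) * 87 ^ (k + 1) *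
              ((k : ℝ) + 3) ^ (4 * (k + 1)) := by ring
    have hfac2 : (((k + 1 + 1)! : ℕ) : ℝ) = (((k + 2)! : ℕ) : ℝ) := by
      rw [show k + 1 + 1 = k + 2 by ring]
    have hrest0 : 0 ≤ (P.X : ℝ) * P.Ω * P.K * s ^ (k + 1) := by have := P.K_pos; positivity
    have key : A * (P.D₀ : ℝ) * (∏ j, (P.D j : ℝ)) * (P.Ω * Q) ≤
        (2 ^ (k + 23) * P.K * P.X * s ^ (k + 1)) * (P.Ω * Q) := by
      calc A * (P.D₀ : ℝ) * (∏ j, (P.D j : ℝ)) * (P.Ω * Q)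
          = A * ((P.D₀ : ℝ) * (P.Ω * ∏ j, (P.D j : ℝ))) * Q := by ring
        _ ≤ A * ((8 * P.X * (Cb ^ (k + 1) * P.Ω * P.K)) * (L / 2 ^ (k + 1 + 22)) ^ (k + 1)) * Q :=
            mul_le_mul_of_nonneg_right (mul_le_mul_of_nonneg_left step1 hA0) hQ0.le
        _ = A * (8 * P.X * (Cb ^ (k + 1) * P.Ω * P.K)) * ((L / 2 ^ (k + 1 + 22)) ^ (k + 1) * Q) := by
            ring
        _ ≤ A * (8 * P.X * (Cb ^ (k + 1) * P.Ω * P.K)) * (s * ((k : ℝ) + 3) ^ 4) ^ (k + 1) :=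
            mul_le_mul_of_nonneg_left step2 (mul_nonneg hA0 hXΩK)
        _ = ((((k + 2)! : ℕ) : ℝ) * (((k + 1)! : ℕ) : ℝ) * 2 ^ (k + 4) * Cb ^ (k + 1) *
              ((k : ℝ) + 3) ^ (4 * (k + 1))) * (P.X * P.Ω * P.K * s ^ (k + 1)) := by
            rw [hA, hfac2, mul_pow, ← pow_mul]; ring
        _ ≤ ((16 * ((k : ℝ) + 2)) ^ (k + 1) * 2 ^ ((k + 1) * (k + 23)) * 2 ^ (k + 23)) *
              (P.X * P.Ω * P.K * s ^ (k + 1)) := mul_le_mul_of_nonneg_right step3 hrest0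
        _ = (2 ^ (k + 23) * P.K * P.X * s ^ (k + 1)) * (P.Ω * Q) := by rw [hQ]; ring
    have hmain := le_of_mul_le_mul_right key (by positivity)
    have hK' : (2 : ℝ) ^ (k + 23) * P.K < 2 ^ (P.Sdepth - 1) := by
      simpa [show k + 1 + 22 = k + 23 by ring] using hK
    have hsk : 0 < s ^ (k + 1) := by positivity
    have hX0 : (0 : ℝ) < P.X := by linarith
    calc A * (P.D₀ : ℝ) * ∏ j, (P.D j : ℝ)
        ≤ 2 ^ (k + 23) * P.K * P.X * s ^ (k + 1) := hmain
      _ < 2 ^ (P.Sdepth - 1) * P.X * s ^ (k + 1) := by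
          apply mul_lt_mul_of_pos_right _ hsk
          exact mul_lt_mul_of_pos_right hK' hX0
      _ < xf * s ^ (k + 1) := mul_lt_mul_of_pos_right hxf hsk
      _ = s ^ (k + 1) * xf := mul_comm _ _

/-- **Exit B is impossible for the record's END parameters** under the instantiation convention
`K ≤ N_q`: hypothesis `hB` of `RecordAssembly.recordTwo_of_ineqs` / `recordOdd_of_ineqs` for
`(D₀, S₀, X, D) := (P.D₀, P.S₀N, P.Xfin, P.D)`. [cite: Nesterenko2003, §5.2 Lemma 5.4] -/
theorem exitB (hKNq : P.K ≤ P.Nq) : ∀ d₀ : ℕ, d₀ ≤ 1 →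
    (n + 1).factorial * 2 ^ n * P.D₀ * ∏ j, P.D j <
      Nat.choose (P.S₀N + (n - d₀)) (n - d₀) * (2 * P.Xfin + 1) * (d₀.factorial * P.D₀ ^ d₀) :=
  exitB_of_bounds (PD := ∏ j, P.D j) (by unfold D₀; omega) le_rfl (P.exitB_zero hKNq) (P.exitB_one hKNq)

end PadicG3Par

end Summit.ABC.StewartYu

end
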